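import Literature.Computability.AlgebraicComplexity.BI17LatinCubeCountTwo
import Literature.Computability.AlgebraicComplexity.BI17AdmissibleTablesProofs
import Literature.Computability.AlgebraicComplexity.BI17DetPerMinimalDegreeProofs
import Literature.Computability.AlgebraicComplexity.BI17TableCountFourCutStar
import HarnessLib

/-!
# Latin cubes are admissible tables (Bürgisser–Ikenmeyer 2017 §5.2): `latinCubeCount n = ± admissibleTableCount n`, Problem 5.23 ⟺ `e(det_n) = n²`, and `BI2017_latinCube_2_4` HOLDS (re-homed proofs)

**Latin cubes are admissible tables: Bürgisser–Ikenmeyer's Problem 5.23 ⟺ `P_{n,n²}(det_n) ≠ 0` ⟺ `e(det_n) = n²`, and the `n = 4`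
Latin-cube fact `BI2017_latinCube_2_4` HOLDS** (Bürgisser–Ikenmeyer, *Fundamental invariants of orbit closures*, J. Algebra 477 (2017),
§3.3 Prop. 3.28 / eq. (3.9); §5.2 Def. 5.21, Prop. 5.22, Problem 5.23 — "we have verified this in the cases `n = 2` and `n = 4`", a computer
verification there) — RE-HOMED into `Literature/` by the Hodge foundations lane (`lit-hodgefound`, seat p20, generation 36) from the
`ValiantsHypothesis` cell `val-lit` (unit val-lit-t03-g6, filed by val-lit-p4/p5): verbatim WHOLE-MODULE ports, each with its original module
docstring, of `Summits/ValiantsHypothesis/ValiantsHypothesis/Theorems/{BI17LatinCubesAdmissibleTables (22 declarations: the bijection Latin cubes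
↔ admissible tables, 10 small `def`s with bodies), BI17LatinCubesAdmissibleTablesCount (27: the sign formula, `latinCubeCount = sign(twist)·
admissibleTableCount`, the equivalences with `cayleyP`/`minimalDegree` of `det_n`, 3 plumbing `def`s)}.lean`, namespace
`Summit.ValiantsHypothesis.BI17LatinCubesAdmissibleTables` re-rooted as `Literature.Computability.AlgebraicComplexity.BI17LatinCubesAdmissibleTables`.
Everything is stated in the tree's own vocabulary (`latinCubeCount`, `latinCubeSign`, `IsLatinCube`, `admissibleTableCount`, `IsAdmissibleTable`,
`cayleyP`, `minimalDegree`, `fundInvariantTensor` of `Literature/Computability/AlgebraicComplexity/BI17*.lean`); the cell's `[folklore]` tags on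
public bookkeeping lemmas are replaced by the Bürgisser–Ikenmeyer locator they serve.

THE DISCHARGE (Part 3).  The Literature named fact `Literature.Computability.AlgebraicComplexity.BI2017_latinCube_2_4`
(`latinCubeCount 2 ≠ 0 ∧ latinCubeCount 4 ≠ 0`, `BI17FundamentalInvariantTensors.lean`) was so far closed only Summits-side
(`Summit.ValiantsHypothesis.BI17LatinCubesAdmissibleTables.BI2017_latinCube_2_4_holds`, `BI17LatinCubeFourHolds.lean`): the hard input
`BI17TwoLevelCut.admissibleTableCount_four_pos` (the 2+2 level cut, Cayley's hyperdeterminant as a Fischer pairing, `SO₆ × SO₆` star-invariance)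
is ALREADY a Literature theorem (`BI17TableCountFourCutStar.lean`), and with Part 2's `BI2017_latinCube_2_4_iff_admissibleTableCount_four` the
EXACT Literature-side twin `BI2017_latinCube_2_4_holds` follows (same one-line proof).  HONEST FRAMING (verbatim from the source files): a
published `n = 4` computer check is now a kernel theorem; nothing here is progress on `VP ≠ VNP`; the `per` half of `BI2017_P416_det_per` stays
open.  No named facts introduced, no instances, no notation; imports Literature only.  The Summits originals stay in place (transitional duplication).
-/

noncomputable section

/-!
## Part 1 — port of `Summits/ValiantsHypothesis/ValiantsHypothesis/Theorems/BI17LatinCubesAdmissibleTables.lean`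

# Latin cubes are admissible tables: BI 2017 Problem 5.23 ⟺ `P_{n,n²}(det_n) ≠ 0` ⟺ `e(det_n) = n²`

Cell `val-lit` (D-0074 GROUP L), BIP corpus, unit val-lit-t03-g6; GAP-LEDGER rows BI2017-A
(`BI2017_P416_det_per`) and BI2017-B (`BI2017_latinCube_2_4`) of the V3 menu (`bears_on`:
`Summit.PneNP.GCT.MultObstructionPer3Det4`, stmt-ValiantsHypothesis-19612 — as bookkeeping of the
BI 2017 toy invariants only). A new (elementary) result, hence filed under `Summits/…/Theorems/`, not
`Literature/`. Theorems and explicit conversion maps only: NO named facts, no instances, no notation,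
unconditional (no BI17 named fact is assumed; three DISCHARGED ones are used by name). HONEST FRAMING:
VP ≠ VNP is NOT proved here or anywhere in the tree and nothing in this file is progress on it.

Source: P. Bürgisser, C. Ikenmeyer, *Fundamental invariants of orbit closures*, J. Algebra 477 (2017)
= arXiv:1511.02927 [BurgisserIkenmeyer2017]. The source evaluates its two "fundamental invariants"
combinatorially and SEPARATELY:
* Prop. 3.28 (§3.3, TeX L1501): `P_{n,n²}(det_n) = #{even} − #{odd admissible n-tables}` (up to the
  factor `(n!)^{n²}` of the tree's normalisation; `BI2017_prop_3_28_holds`), followed by "for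
  geometric complexity theory it would be important to know whether `P_{n,n²}` vanishes on `det_n`",
  i.e. whether `e(det_n) = n²` (Prop. 3.25(2), `BI2017_minimalDegree_det_per_holds`), checked by
  computer for `n = 2, 4` (eq. (3.9), fact `BI2017_P416_det_per`);
* Prop. 5.22 / Def. 5.21 / Problem 5.23 (§5.2, TeX L2422–2457): `F_n(⟨n²⟩) = #{even} − #{odd
  Latin cubes of size n}` (`BI2017_prop_5_22_holds`); "The following question, which is analogous
  to the Alon–Tarsi conjecture, is important for understanding tensor border rank. We have verified
  this in the cases `n = 2` and `n = 4`" (fact `BI2017_latinCube_2_4`).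

**This file proves that the two counts are the same count.** An admissible `n`-table `(S,T)`
(rows of `S`, `T` permutations of `[n]`, every column `i ↦ (S(i,j),T(i,j))` a bijection
`[n²] → [n]×[n]`) IS a Latin cube of size `n`: put the symbol `i` (the table row) at the cells
`(S(i,z), T(i,z), z)`, `z ∈ [n]` — a "3D diagonal"; column-bijectivity is `z`-slice bijectivity,
and the rows of `S` (resp. `T`) being permutations is `x`- (resp. `y`-) slice bijectivity
(`cubeOfTable`, `tableOfCube`, `isLatinCube_cubeOfTable`, `isAdmissibleTable_tableOfCube`, the two
inverse laws). Under this bijection the signs agree up to a FIXED sign (`latinCubeSign_cubeOfTable`):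
* the `z`-slice maps are the inverses of the column bijections, so `sgn_z = csgn(S,T)`
  (`labelSignZ_cubeOfTable`);
* `rsgn(S)·rsgn(T) = ∏_i sgn(π_i)` with `π_i = T(i,·)∘S(i,·)⁻¹` the pattern of the `i`-th diagonal
  (`tableRowSign_mul_tableRowSign`);
* `sgn_x · sgn_y = sign(twist_n) · ∏_i sgn(π_i)` (`labelSignX_mul_labelSignY`): the block
  permutation `(r,i) ↦ (r, x-position of i in slice r)` of `[n]×[n²]` factors as
  `twist_n ∘ ((c,i) ↦ (c, y-position)) ∘ ((r,i) ↦ (π_i r, i))` (`prodCongrRight_posX`), and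
  Mathlib's `sign_prodCongrRight/Left` read off the three signs; `twist_n` is the fixed involution
  `(a, (b,z)) ↦ (b, (a,z))`, of sign `sign(swap on [n]×[n])^n` (`sign_twist`), `= 1` for even `n`.
Hence (`latinCubeCount_eq_sign_twist_mul_admissibleTableCount`,
`latinCubeCount_eq_admissibleTableCount_of_even`, `latinCubeCount_ne_zero_iff`)
`#{even} − #{odd Latin cubes of size n} = sign(twist_n)·(#{even} − #{odd admissible n-tables})`,
and with the tree's discharged Props 3.25, 3.28, 5.22:
* `fundInvariantTensor_unitTensor_eq_cayleyP_det`: `F_n(⟨n²⟩) = ±(n!)^{n²}·P_{n,n²}(det_n)`;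
* **`latinCubeQuestion_iff_minimalDegree_det`** (`2 ≤ n`): BI Problem 5.23 holds for `n` iff
  `e(det_n) = n²` iff `P_{n,n²}(det_n) ≠ 0` (`latinCubeQuestion_iff_cayleyP_det_ne_zero`);
* the two computational facts of the tree are one: `BI2017_latinCube_2_4 ↔ P_{4,16}(det_4) ≠ 0`
  (`BI2017_latinCube_2_4_iff_cayleyP_det_four`, `…_iff_admissibleTableCount_four`; the `n = 2`
  conjunct is the theorem `latinCubeCount_two_ne_zero`), `BI2017_P416_det_per → BI2017_latinCube_2_4`
  (`BI2017_latinCube_2_4_of_P416`), `BI2017_latinCube_2_4 → e(det_4) = 16`.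
Neither BI 2017 nor Amanov–Yeliussizov (IMRN 2023, arXiv:2202.11059 §7.3, where the Latin-cube count
is `AT₃(n)` and "in [BI] it is also noted that computations show `AT₃(4) ≠ 0`") state this link; the
nearest printed item, Li–Zhang–Xia (LAA, arXiv:2111.07343) §5, attaches to each symbol `s` of a Latin
cube its 3D permutation matrix `P_s = {(i, σ(i), τ(i))}` (the diagonal above) and the "symbol sign"
`∏_s sgn(σ_{P_s}) sgn(τ_{P_s})` (`= rsgn(T)` in the table language), and poses as Problem 5.7 the
relation between the symbol-parity and the slice-parity counts — a different pairing from the one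
settled here. The link is elementary and recorded as [folklore] (val-lit presearch, lit g8 03:23Z:
not found in print). Numbers of record (val-lit NOTE-t03g6-P416-sizing.md,
exact meet-in-the-middle enumeration, not kernel-certified): `#{normalized Latin cubes of size 4} =
368 436 584 448`, `|latinCubeCount 4| = 16!·109 734 912 000`, `P_{4,16}(det_4) = 5364734375/28311552`.

## References

* [BurgisserIkenmeyer2017] P. Bürgisser, C. Ikenmeyer, arXiv:1511.02927, §3.3 (admissible tables,
  Prop. 3.28, eq. (3.9)), Prop. 3.25, §5.2 (Def. 5.21, Prop. 5.22, Problem 5.23).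
* A. Amanov, D. Yeliussizov, *Fundamental invariants of tensors, Latin hypercubes, and rectangular
  Kronecker coefficients*, IMRN 2023, arXiv:2202.11059, §7.3 (context only).
* X. Li, L. Zhang, H. Xia, *Two classes of minimal generic fundamental invariants for tensors*,
  Linear Algebra Appl., arXiv:2111.07343, §5 (Prop. 5.1, Prop. 5.6, Problem 5.7; context only).

## Tree

`IsAdmissibleTable`, `tableRowSign`, `tableColSign`, `admissibleTableCount`, `BI2017_prop_3_28`,
`BI2017_minimalDegree_det_per`, `BI2017_P416_det_per` (`BI17FundamentalInvariantForms`);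
`IsLatinCube`, `x/y/zSliceMap`, `sliceSign`, `labelSignX/Y/Z`, `latinCubeSign`, `latinCubeCount`,
`latinCubeQuestion`, `BI2017_prop_5_22(_holds)`, `BI2017_latinCube_2_4` (`BI17FundamentalInvariantTensors`);
`latinCubeCount_two_ne_zero` (`BI17LatinCubeCountTwo`); `BI2017_prop_3_28_holds`
(`BI17AdmissibleTablesProofs`); `BI2017_minimalDegree_det_per_holds` (`BI17DetPerMinimalDegreeProofs`);
`Kumar2015.seqSign`, `seqSign_coe_perm` (`KumarLatinRectangles`). Mathlib: `finProdFinEquiv`,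
`Fintype.bijInv`, `Equiv.ofBijective`, `Equiv.prodCongrLeft/Right`, `Equiv.Perm.sign_prodCongrLeft/Right`,
`Equiv.Perm.sign_trans_trans`, `Finset.sum_nbij'`, `Int.units_eq_one_or`.

FILE SPLIT (gate rule: Theorems files with proofs ≤ 400 lines): this is PART 1 of 2 — the conversion
`cubeOfTable` / `tableOfCube`, the slice maps and slice signs of the cube of an admissible table.
PART 2 (`BI17LatinCubesAdmissibleTablesCount.lean`): the twist and its sign, the sign formula
`latinCubeSign_cubeOfTable`, the inverse laws, the signed counts and the consequences / edges listed
above. Typed by val-lit-t03 g6; filed verbatim (split only) by prover val-lit-p4 g5.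
-/

section Part1

namespace Literature.Computability.AlgebraicComplexity.BI17LatinCubesAdmissibleTables

open _root_.Finset _root_.Equiv Literature.Computability.AlgebraicComplexity

variable {n : ℕ}

/-! ### From an admissible table to a labeling of the cube -/

open scoped _root_.Classical in
/-- The labeling of the combinatorial cube `[n]³` attached to a table `(S,T)`: the cell `(r, c, z)`
carries the symbol `i` (the table row) with `(S(i,z), T(i,z)) = (r, c)`, i.e. symbol `i` occupies the
"diagonal" `{(S(i,z), T(i,z), z) : z ∈ [n]}`; defined through `Fintype.bijInv` of the column maps
(junk value when the column `z` of the table is not a bijection). [cite: BurgisserIkenmeyer2017, §5.2 Def. 5.21 / Prop. 5.22 (Latin cubes and admissible tables; elementary bookkeeping for Problem 5.23)] -/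
noncomputable def cubeOfTable (S T : Fin (n * n) → Fin n → Fin n) :
    Fin n × Fin n × Fin n → Fin (n * n) := fun p =>
  if h : Function.Bijective (fun i : Fin (n * n) => (S i p.2.2, T i p.2.2)) then
    Fintype.bijInv h (p.1, p.2.1)
  else finProdFinEquiv (p.1, p.2.1)

open scoped _root_.Classical in
/-- The table attached to a labeling `α : [n]³ → [n²]`: `S(i,z)` and `T(i,z)` are the row and the
column of the cell of the `z`-slice carrying the symbol `i` (junk when that slice is not a
bijection). [cite: BurgisserIkenmeyer2017, §5.2 Def. 5.21 / Prop. 5.22 (Latin cubes and admissible tables; elementary bookkeeping for Problem 5.23)] -/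
noncomputable def tableOfCube (n : ℕ) (α : Fin n × Fin n × Fin n → Fin (n * n)) :
    (Fin (n * n) → Fin n → Fin n) × (Fin (n * n) → Fin n → Fin n) :=
  (fun i z =>
      if h : Function.Bijective (zSliceMap n α z) then
        (finProdFinEquiv.symm ((Equiv.ofBijective _ h).symm i)).1
      else (finProdFinEquiv.symm i).1,
    fun i z =>
      if h : Function.Bijective (zSliceMap n α z) then
        (finProdFinEquiv.symm ((Equiv.ofBijective _ h).symm i)).2
      else (finProdFinEquiv.symm i).2)

section Table

variable {S T : Fin (n * n) → Fin n → Fin n} (h : IsAdmissibleTable S T)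
include h

/-- The defining property of `cubeOfTable`: the symbol at `(r, c, z)` is the table row `i` with
`(S(i,z), T(i,z)) = (r, c)`. [cite: BurgisserIkenmeyer2017, §5.2 Def. 5.21 / Prop. 5.22 (Latin cubes and admissible tables; elementary bookkeeping for Problem 5.23)] -/
theorem cubeOfTable_spec (r c z : Fin n) :
    S (cubeOfTable S T (r, c, z)) z = r ∧ T (cubeOfTable S T (r, c, z)) z = c := by
  have hb := h.2.2 z
  have := Fintype.rightInverse_bijInv hb (r, c)
  simp only [cubeOfTable, dif_pos hb]
  exact ⟨congrArg Prod.fst this, congrArg Prod.snd this⟩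

/-- Uniqueness: if `(S(i,z), T(i,z)) = (r,c)` then the symbol at `(r,c,z)` is `i`. [cite: BurgisserIkenmeyer2017, §5.2 Def. 5.21 / Prop. 5.22 (Latin cubes and admissible tables; elementary bookkeeping for Problem 5.23)] -/
theorem cubeOfTable_eq_of {r c z : Fin n} {i : Fin (n * n)} (hr : S i z = r) (hc : T i z = c) :
    cubeOfTable S T (r, c, z) = i := by
  have hb := h.2.2 z
  apply hb.1
  have h1 := cubeOfTable_spec h r c z
  simp only [Prod.mk.injEq]
  exact ⟨h1.1.trans hr.symm, h1.2.trans hc.symm⟩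

/-- The row permutations `S(i,·)`, `T(i,·)` of an admissible table, as permutations. [cite: BurgisserIkenmeyer2017, §5.2 Def. 5.21 / Prop. 5.22 (Latin cubes and admissible tables; elementary bookkeeping for Problem 5.23)] -/
noncomputable def rowPermS (i : Fin (n * n)) : Equiv.Perm (Fin n) := Equiv.ofBijective (S i) (h.1 i)
/-- See `rowPermS`. [cite: BurgisserIkenmeyer2017, §5.2 Def. 5.21 / Prop. 5.22 (Latin cubes and admissible tables; elementary bookkeeping for Problem 5.23)] -/
noncomputable def rowPermT (i : Fin (n * n)) : Equiv.Perm (Fin n) := Equiv.ofBijective (T i) (h.2.1 i)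

/-- The permutation pattern `π_i = T(i,·) ∘ S(i,·)⁻¹` of the `i`-th row (row ↦ column of the
diagonal of the symbol `i`). [cite: BurgisserIkenmeyer2017, §5.2 Def. 5.21 / Prop. 5.22 (Latin cubes and admissible tables; elementary bookkeeping for Problem 5.23)] -/
noncomputable def pat (i : Fin (n * n)) : Equiv.Perm (Fin n) := (rowPermS h i).symm.trans (rowPermT h i)

/-- The column bijection `i ↦ (S(i,z), T(i,z))` of an admissible table read in `[n²]` through
`finProdFinEquiv`, as a permutation. [cite: BurgisserIkenmeyer2017, §5.2 Def. 5.21 / Prop. 5.22 (Latin cubes and admissible tables; elementary bookkeeping for Problem 5.23)] -/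
noncomputable def colPerm (z : Fin n) : Equiv.Perm (Fin (n * n)) :=
  Equiv.ofBijective (fun i => finProdFinEquiv (S i z, T i z)) (finProdFinEquiv.bijective.comp (h.2.2 z))

/-- Position of the symbol `i` in the `x`-slice `r`: `(c, z) = (T(i,z), S(i,·)⁻¹ r)` read in `[n²]`. [cite: BurgisserIkenmeyer2017, §5.2 Def. 5.21 / Prop. 5.22 (Latin cubes and admissible tables; elementary bookkeeping for Problem 5.23)] -/
noncomputable def posXFun (r : Fin n) (i : Fin (n * n)) : Fin (n * n) :=
  finProdFinEquiv (T i ((rowPermS h i).symm r), (rowPermS h i).symm r)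

/-- Position of the symbol `i` in the `y`-slice `c`: `(r, z) = (S(i,z), T(i,·)⁻¹ c)` read in `[n²]`. [cite: BurgisserIkenmeyer2017, §5.2 Def. 5.21 / Prop. 5.22 (Latin cubes and admissible tables; elementary bookkeeping for Problem 5.23)] -/
noncomputable def posYFun (c : Fin n) (i : Fin (n * n)) : Fin (n * n) :=
  finProdFinEquiv (S i ((rowPermT h i).symm c), (rowPermT h i).symm c)

/-- Distinct symbols occupy distinct cells of an `x`-slice. [cite: BurgisserIkenmeyer2017, §5.2 Def. 5.21 / Prop. 5.22 (Latin cubes and admissible tables; elementary bookkeeping for Problem 5.23)] -/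
theorem posXFun_injective (r : Fin n) : Function.Injective (posXFun h r) := by
  intro i j hij
  unfold posXFun at hij
  have hij' := finProdFinEquiv.injective hij
  simp only [Prod.mk.injEq] at hij'
  obtain ⟨hT, hz⟩ := hij'
  have hSi : S i ((rowPermS h i).symm r) = r := Equiv.ofBijective_apply_symm_apply (S i) (h.1 i) r
  have hSj : S j ((rowPermS h j).symm r) = r := Equiv.ofBijective_apply_symm_apply (S j) (h.1 j) r
  apply (h.2.2 ((rowPermS h i).symm r)).1
  simp only [Prod.mk.injEq]
  refine ⟨?_, ?_⟩
  · rw [hSi]; conv_rhs => rw [hz]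
    rw [hSj]
  · rw [hT]; conv_rhs => rw [hz]

/-- Distinct symbols occupy distinct cells of a `y`-slice. [cite: BurgisserIkenmeyer2017, §5.2 Def. 5.21 / Prop. 5.22 (Latin cubes and admissible tables; elementary bookkeeping for Problem 5.23)] -/
theorem posYFun_injective (c : Fin n) : Function.Injective (posYFun h c) := by
  intro i j hij
  unfold posYFun at hij
  have hij' := finProdFinEquiv.injective hij
  simp only [Prod.mk.injEq] at hij'
  obtain ⟨hS, hz⟩ := hij'
  have hTi : T i ((rowPermT h i).symm c) = c := Equiv.ofBijective_apply_symm_apply (T i) (h.2.1 i) c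
  have hTj : T j ((rowPermT h j).symm c) = c := Equiv.ofBijective_apply_symm_apply (T j) (h.2.1 j) c
  apply (h.2.2 ((rowPermT h i).symm c)).1
  simp only [Prod.mk.injEq]
  refine ⟨?_, ?_⟩
  · rw [hS]; conv_rhs => rw [hz]
  · rw [hTi]; conv_rhs => rw [hz]
    rw [hTj]

/-- `posXFun` as a permutation of `[n²]`. [cite: BurgisserIkenmeyer2017, §5.2 Def. 5.21 / Prop. 5.22 (Latin cubes and admissible tables; elementary bookkeeping for Problem 5.23)] -/
noncomputable def posX (r : Fin n) : Equiv.Perm (Fin (n * n)) :=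
  Equiv.ofBijective (posXFun h r) (Finite.injective_iff_bijective.mp (posXFun_injective h r))
/-- `posYFun` as a permutation of `[n²]`. [cite: BurgisserIkenmeyer2017, §5.2 Def. 5.21 / Prop. 5.22 (Latin cubes and admissible tables; elementary bookkeeping for Problem 5.23)] -/
noncomputable def posY (c : Fin n) : Equiv.Perm (Fin (n * n)) :=
  Equiv.ofBijective (posYFun h c) (Finite.injective_iff_bijective.mp (posYFun_injective h c))

/-- The `x`-slices of the cube of an admissible table are the inverses of the position maps. [cite: BurgisserIkenmeyer2017, §5.2 Def. 5.21 / Prop. 5.22 (Latin cubes and admissible tables; elementary bookkeeping for Problem 5.23)] -/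
theorem xSliceMap_cubeOfTable (r : Fin n) : xSliceMap n (cubeOfTable S T) r = ⇑(posX h r).symm := by
  funext q
  rw [eq_comm, Equiv.symm_apply_eq]
  -- `q = posX (α (r, e⁻¹ q))`
  set c := (finProdFinEquiv.symm q).1
  set z := (finProdFinEquiv.symm q).2
  have hspec := cubeOfTable_spec h r c z
  set i := cubeOfTable S T (r, c, z)
  have hz : (rowPermS h i).symm r = z := by
    rw [Equiv.symm_apply_eq]; exact hspec.1.symm
  show q = finProdFinEquiv (T i ((rowPermS h i).symm r), (rowPermS h i).symm r)
  rw [hz, hspec.2]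
  exact (finProdFinEquiv.apply_symm_apply q).symm

/-- The `y`-slices likewise. [cite: BurgisserIkenmeyer2017, §5.2 Def. 5.21 / Prop. 5.22 (Latin cubes and admissible tables; elementary bookkeeping for Problem 5.23)] -/
theorem ySliceMap_cubeOfTable (c : Fin n) : ySliceMap n (cubeOfTable S T) c = ⇑(posY h c).symm := by
  funext q
  rw [eq_comm, Equiv.symm_apply_eq]
  set r := (finProdFinEquiv.symm q).1
  set z := (finProdFinEquiv.symm q).2
  have hspec := cubeOfTable_spec h r c z
  set i := cubeOfTable S T (r, c, z)
  have hz : (rowPermT h i).symm c = z := by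
    rw [Equiv.symm_apply_eq]; exact hspec.2.symm
  show q = finProdFinEquiv (S i ((rowPermT h i).symm c), (rowPermT h i).symm c)
  rw [hz, hspec.1]
  exact (finProdFinEquiv.apply_symm_apply q).symm

/-- The `z`-slices are the inverses of the column permutations. [cite: BurgisserIkenmeyer2017, §5.2 Def. 5.21 / Prop. 5.22 (Latin cubes and admissible tables; elementary bookkeeping for Problem 5.23)] -/
theorem zSliceMap_cubeOfTable (z : Fin n) : zSliceMap n (cubeOfTable S T) z = ⇑(colPerm h z).symm := by
  funext q
  rw [eq_comm, Equiv.symm_apply_eq]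
  set r := (finProdFinEquiv.symm q).1
  set c := (finProdFinEquiv.symm q).2
  have hspec := cubeOfTable_spec h r c z
  set i := cubeOfTable S T (r, c, z)
  show q = finProdFinEquiv (S i z, T i z)
  rw [hspec.1, hspec.2]
  exact (finProdFinEquiv.apply_symm_apply q).symm

/-- The cube of an admissible table is a Latin cube. [cite: BurgisserIkenmeyer2017, §5.2 Def. 5.21 / Prop. 5.22 (Latin cubes and admissible tables; elementary bookkeeping for Problem 5.23)] -/
theorem isLatinCube_cubeOfTable : IsLatinCube n (cubeOfTable S T) := by
  refine ⟨fun r => ?_, fun c => ?_, fun z => ?_⟩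
  · rw [xSliceMap_cubeOfTable h]; exact (posX h r).symm.bijective
  · rw [ySliceMap_cubeOfTable h]; exact (posY h c).symm.bijective
  · rw [zSliceMap_cubeOfTable h]; exact (colPerm h z).symm.bijective

/-! ### Slice signs of the cube of an admissible table -/

/-- `z`-slice signs = column signs. [cite: BurgisserIkenmeyer2017, §5.2 Def. 5.21 / Prop. 5.22 (Latin cubes and admissible tables; elementary bookkeeping for Problem 5.23)] -/
theorem labelSignZ_cubeOfTable :
    labelSignZ n (cubeOfTable S T) = ((tableColSign S T : ℤˣ) : ℤ) := by
  have hbij : ∀ ℓ, Function.Bijective (zSliceMap n (cubeOfTable S T) ℓ) := fun ℓ => by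
    rw [zSliceMap_cubeOfTable h]; exact (colPerm h ℓ).symm.bijective
  rw [labelSignZ, sliceSign, if_pos hbij, tableColSign, Units.coe_prod]
  refine Finset.prod_congr rfl fun ℓ _ => ?_
  rw [zSliceMap_cubeOfTable h, Kumar2015.seqSign_coe_perm, Equiv.Perm.sign_symm]
  have : (fun i => finProdFinEquiv (S i ℓ, T i ℓ)) = ⇑(colPerm h ℓ) := rfl
  rw [this, Kumar2015.seqSign_coe_perm]

/-- Row signs: `rsgn(S) · rsgn(T) = ∏_i sgn(π_i)`. [cite: BurgisserIkenmeyer2017, §5.2 Def. 5.21 / Prop. 5.22 (Latin cubes and admissible tables; elementary bookkeeping for Problem 5.23)] -/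
theorem tableRowSign_mul_tableRowSign :
    tableRowSign S * tableRowSign T = ∏ i, Equiv.Perm.sign (pat h i) := by
  rw [tableRowSign, tableRowSign, ← Finset.prod_mul_distrib]
  refine Finset.prod_congr rfl fun i _ => ?_
  have hS : (S i) = ⇑(rowPermS h i) := rfl
  have hT : (T i) = ⇑(rowPermT h i) := rfl
  rw [hS, hT, Kumar2015.seqSign_coe_perm, Kumar2015.seqSign_coe_perm, pat, Equiv.Perm.sign_trans,
    Equiv.Perm.sign_symm, mul_comm]

/-- `x`-slice signs through the position permutations. [cite: BurgisserIkenmeyer2017, §5.2 Def. 5.21 / Prop. 5.22 (Latin cubes and admissible tables; elementary bookkeeping for Problem 5.23)] -/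
theorem labelSignX_cubeOfTable :
    labelSignX n (cubeOfTable S T) = ((∏ r, Equiv.Perm.sign (posX h r) : ℤˣ) : ℤ) := by
  have hbij : ∀ ℓ, Function.Bijective (xSliceMap n (cubeOfTable S T) ℓ) := fun ℓ => by
    rw [xSliceMap_cubeOfTable h]; exact (posX h ℓ).symm.bijective
  rw [labelSignX, sliceSign, if_pos hbij, Units.coe_prod]
  refine Finset.prod_congr rfl fun ℓ _ => ?_
  rw [xSliceMap_cubeOfTable h, Kumar2015.seqSign_coe_perm, Equiv.Perm.sign_symm]

/-- `y`-slice signs through the position permutations. [cite: BurgisserIkenmeyer2017, §5.2 Def. 5.21 / Prop. 5.22 (Latin cubes and admissible tables; elementary bookkeeping for Problem 5.23)] -/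
theorem labelSignY_cubeOfTable :
    labelSignY n (cubeOfTable S T) = ((∏ c, Equiv.Perm.sign (posY h c) : ℤˣ) : ℤ) := by
  have hbij : ∀ ℓ, Function.Bijective (ySliceMap n (cubeOfTable S T) ℓ) := fun ℓ => by
    rw [ySliceMap_cubeOfTable h]; exact (posY h ℓ).symm.bijective
  rw [labelSignY, sliceSign, if_pos hbij, Units.coe_prod]
  refine Finset.prod_congr rfl fun ℓ _ => ?_
  rw [ySliceMap_cubeOfTable h, Kumar2015.seqSign_coe_perm, Equiv.Perm.sign_symm]

end Table

end Literature.Computability.AlgebraicComplexity.BI17LatinCubesAdmissibleTables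

end Part1

/-!
## Part 2 — port of `Summits/ValiantsHypothesis/ValiantsHypothesis/Theorems/BI17LatinCubesAdmissibleTablesCount.lean`

# Latin cubes are admissible tables — part 2: the sign formula, the signed counts, and the consequences

PART 2 of 2 of val-lit-t03 g6's file (see the module docstring of
`BI17LatinCubesAdmissibleTables.lean`, part 1, for the full account, references and honest framing):

* the fixed twist `(a, (b, z)) ↦ (b, (a, z))` of `[n] × [n²]` and its sign (`sign_twist`);
* the sign formula `latinCubeSign_cubeOfTable : latinCubeSign n (cubeOfTable S T) =
  sign (twist n) · (rsgn S · rsgn T · csgn (S,T))`;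
* the inverse laws `cubeOfTable_tableOfCube`, `tableOfCube_cubeOfTable` (Latin cubes of size `n` ARE
  admissible `n`-tables);
* `latinCubeCount_eq_sign_twist_mul_admissibleTableCount`, `latinCubeCount_eq_admissibleTableCount_of_even`,
  `latinCubeCount_ne_zero_iff`;
* consequences: `fundInvariantTensor_unitTensor_eq_cayleyP_det` (`F_n(⟨n²⟩) = ± (n!)^{n²} P_{n,n²}(det_n)`),
  `latinCubeQuestion_iff_minimalDegree_det` (BI Problem 5.23 ⟺ `e(det_n) = n²`, `n ≥ 2`),
  `latinCubeQuestion_iff_cayleyP_det_ne_zero`; edges `BI2017_latinCube_2_4_iff_admissibleTableCount_four`,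
  `BI2017_latinCube_2_4_iff_cayleyP_det_four`, `BI2017_latinCube_2_4_of_P416`,
  `minimalDegree_det_four_of_latinCube` — the two computational facts of the tree
  (`BI2017_latinCube_2_4`, the `det` half of `BI2017_P416_det_per`) are ONE open computation.

Theorem-only apart from the three plumbing defs `splitEquiv`, `twist₀`, `twist` (with bodies); no named
facts, no instances, no notation. Honest framing: elementary bookkeeping inside BI 2017's toy invariants
(§3.3 Prop. 3.28 / eq. (3.9); §5.2 Def. 5.21, Prop. 5.22, Problem 5.23); VP ≠ VNP is NOT proved and
nothing here is progress on it. Typed by val-lit-t03 g6 (unit val-lit-t03-g6); filed verbatim (split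
only) by prover val-lit-p4 g5 (lead-bip RULINGS #19 (3)).

## References
* [BurgisserIkenmeyer2017] P. Bürgisser, C. Ikenmeyer, *Fundamental invariants of orbit closures*,
  J. Algebra 477 (2017) 390–434, §3.3 Prop. 3.28 / eq. (3.9); §5.2 Def. 5.21, Prop. 5.22, Problem 5.23.
-/

section Part2

namespace Literature.Computability.AlgebraicComplexity.BI17LatinCubesAdmissibleTables

open _root_.Finset _root_.Equiv Literature.Computability.AlgebraicComplexity

variable {n : ℕ}

/-! ### The fixed twist `(a, (b, z)) ↦ (b, (a, z))` of `[n] × [n²]` and its sign -/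

/-- `[n] × [n²] ≃ [n] × ([n] × [n])` through `finProdFinEquiv`. [cite: BurgisserIkenmeyer2017, §5.2 Prop. 5.22 / Problem 5.23 with §3.3 Prop. 3.28, eq. (3.9) (signed counts, F_n(⟨n²⟩) = ±(n!)^{n²} P_{n,n²}(det_n))] -/
def splitEquiv (n : ℕ) : Fin n × Fin (n * n) ≃ Fin n × (Fin n × Fin n) :=
  Equiv.prodCongr (Equiv.refl _) finProdFinEquiv.symm

/-- The coordinate twist `(c, (r, z)) ↦ (r, (c, z))` of `[n] × ([n] × [n])`. [cite: BurgisserIkenmeyer2017, §5.2 Prop. 5.22 / Problem 5.23 with §3.3 Prop. 3.28, eq. (3.9) (signed counts, F_n(⟨n²⟩) = ±(n!)^{n²} P_{n,n²}(det_n))] -/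
def twist₀ (n : ℕ) : Equiv.Perm (Fin n × (Fin n × Fin n)) :=
  (Equiv.prodAssoc (Fin n) (Fin n) (Fin n)).symm.trans
    ((Equiv.prodCongr (Equiv.prodComm (Fin n) (Fin n)) (Equiv.refl (Fin n))).trans
      (Equiv.prodAssoc (Fin n) (Fin n) (Fin n)))

/-- The twist `(a, e(b, z)) ↦ (b, e(a, z))` of `[n] × [n²]` (`e = finProdFinEquiv`): the fixed
permutation relating the `x`-positions and the `y`-positions of the symbols. [cite: BurgisserIkenmeyer2017, §5.2 Prop. 5.22 / Problem 5.23 with §3.3 Prop. 3.28, eq. (3.9) (signed counts, F_n(⟨n²⟩) = ±(n!)^{n²} P_{n,n²}(det_n))] -/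
def twist (n : ℕ) : Equiv.Perm (Fin n × Fin (n * n)) :=
  (splitEquiv n).trans ((twist₀ n).trans (splitEquiv n).symm)

/-- The twist on split coordinates. [cite: BurgisserIkenmeyer2017, §5.2 Prop. 5.22 / Problem 5.23 with §3.3 Prop. 3.28, eq. (3.9) (signed counts, F_n(⟨n²⟩) = ±(n!)^{n²} P_{n,n²}(det_n))] -/
theorem twist_apply (a b z : Fin n) :
    twist n (a, finProdFinEquiv (b, z)) = (b, finProdFinEquiv (a, z)) := by
  simp [twist, twist₀, splitEquiv]

/-- `sign(twist) = sign(prodComm on [n]×[n])^n` (stated in `ℤ`: the `ℕ`-power on `ℤˣ` elaborates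
through the `ℤˣ`-module instance, not `Monoid.npow`). [cite: BurgisserIkenmeyer2017, §5.2 Prop. 5.22 / Problem 5.23 with §3.3 Prop. 3.28, eq. (3.9) (signed counts, F_n(⟨n²⟩) = ±(n!)^{n²} P_{n,n²}(det_n))] -/
theorem sign_twist (n : ℕ) :
    ((Equiv.Perm.sign (twist n) : ℤˣ) : ℤ) =
      ((Equiv.Perm.sign (Equiv.prodComm (Fin n) (Fin n)) : ℤˣ) : ℤ) ^ n := by
  have h1 : Equiv.Perm.sign (twist n) = Equiv.Perm.sign (twist₀ n) := by
    rw [twist, Equiv.Perm.sign_trans_trans, Equiv.self_trans_symm, Equiv.Perm.sign_refl, mul_one]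
  have h2 : Equiv.Perm.sign (twist₀ n) =
      Equiv.Perm.sign (Equiv.prodCongr (Equiv.prodComm (Fin n) (Fin n)) (Equiv.refl (Fin n))) := by
    rw [twist₀, Equiv.Perm.sign_trans_trans, Equiv.symm_trans_self, Equiv.Perm.sign_refl, mul_one]
  have h3 : (Equiv.prodCongr (Equiv.prodComm (Fin n) (Fin n)) (Equiv.refl (Fin n)) :
      Equiv.Perm ((Fin n × Fin n) × Fin n)) =
      Equiv.prodCongrLeft fun _ : Fin n => Equiv.prodComm (Fin n) (Fin n) := by
    ext ⟨x, z⟩ <;> rfl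
  rw [h1, h2, h3, Equiv.Perm.sign_prodCongrLeft, Finset.prod_const, Finset.card_univ,
    Fintype.card_fin, Units.val_pow_eq_pow_val]

section Table

variable {S T : Fin (n * n) → Fin n → Fin n} (h : IsAdmissibleTable S T)
include h

/-- **Key identity**: the `x`-position permutation factors as twist ∘ `y`-positions ∘ patterns. [cite: BurgisserIkenmeyer2017, §5.2 Prop. 5.22 / Problem 5.23 with §3.3 Prop. 3.28, eq. (3.9) (signed counts, F_n(⟨n²⟩) = ±(n!)^{n²} P_{n,n²}(det_n))] -/
theorem prodCongrRight_posX :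
    (Equiv.prodCongrRight (posX h) : Equiv.Perm (Fin n × Fin (n * n))) =
      twist n * (Equiv.prodCongrRight (posY h) * Equiv.prodCongrLeft (pat h)) := by
  refine Equiv.ext fun ⟨r, i⟩ => ?_
  rw [Equiv.Perm.mul_apply, Equiv.Perm.mul_apply, Equiv.prodCongrLeft_apply,
    Equiv.prodCongrRight_apply, Equiv.prodCongrRight_apply]
  set z := (rowPermS h i).symm r with hz
  have hSz : S i z = r := Equiv.ofBijective_apply_symm_apply (S i) (h.1 i) r
  have hpat : pat h i r = T i z := rfl
  have hw : (rowPermT h i).symm (T i z) = z :=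
    Equiv.ofBijective_symm_apply_apply (T i) (h.2.1 i) z
  rw [hpat]
  show (r, finProdFinEquiv (T i z, z)) =
    twist n (T i z, finProdFinEquiv (S i ((rowPermT h i).symm (T i z)), (rowPermT h i).symm (T i z)))
  rw [hw, hSz, twist_apply]

/-- `sgn_x · sgn_y = sign(twist) · ∏_i sgn(π_i)`. [cite: BurgisserIkenmeyer2017, §5.2 Prop. 5.22 / Problem 5.23 with §3.3 Prop. 3.28, eq. (3.9) (signed counts, F_n(⟨n²⟩) = ±(n!)^{n²} P_{n,n²}(det_n))] -/
theorem labelSignX_mul_labelSignY :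
    labelSignX n (cubeOfTable S T) * labelSignY n (cubeOfTable S T) =
      ((Equiv.Perm.sign (twist n) * ∏ i, Equiv.Perm.sign (pat h i) : ℤˣ) : ℤ) := by
  rw [labelSignX_cubeOfTable h, labelSignY_cubeOfTable h, ← Units.val_mul]
  congr 1
  rw [← Equiv.Perm.sign_prodCongrRight, ← Equiv.Perm.sign_prodCongrRight, prodCongrRight_posX h,
    Equiv.Perm.sign_mul, Equiv.Perm.sign_mul, ← Equiv.Perm.sign_prodCongrLeft]
  set a := Equiv.Perm.sign (twist n)
  set b := Equiv.Perm.sign (Equiv.prodCongrRight (posY h) : Equiv.Perm (Fin n × Fin (n * n)))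
  set c := Equiv.Perm.sign (Equiv.prodCongrLeft (pat h) : Equiv.Perm (Fin n × Fin (n * n)))
  show a * (b * c) * b = a * c
  rw [mul_assoc a (b * c) b, mul_comm b c, mul_assoc c b b, Int.units_mul_self, mul_one]

/-- **The sign of the Latin cube of an admissible table**:
`sgn(α_{S,T}) = sign(twist_n) · rsgn(S) rsgn(T) csgn(S,T)`. [cite: BurgisserIkenmeyer2017, §5.2 Prop. 5.22 / Problem 5.23 with §3.3 Prop. 3.28, eq. (3.9) (signed counts, F_n(⟨n²⟩) = ±(n!)^{n²} P_{n,n²}(det_n))] -/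
theorem latinCubeSign_cubeOfTable :
    latinCubeSign n (cubeOfTable S T) =
      ((Equiv.Perm.sign (twist n) : ℤˣ) : ℤ) *
        ((tableRowSign S * tableRowSign T * tableColSign S T : ℤˣ) : ℤ) := by
  rw [latinCubeSign, labelSignX_mul_labelSignY h, labelSignZ_cubeOfTable h,
    tableRowSign_mul_tableRowSign h, ← Units.val_mul, ← Units.val_mul, mul_assoc]

end Table

/-! ### From a Latin cube back to its table -/

section Cube

variable {α : Fin n × Fin n × Fin n → Fin (n * n)} (hα : IsLatinCube n α)
include hα

/-- Unfolding `tableOfCube` on a Latin cube (first table). [cite: BurgisserIkenmeyer2017, §5.2 Prop. 5.22 / Problem 5.23 with §3.3 Prop. 3.28, eq. (3.9) (signed counts, F_n(⟨n²⟩) = ±(n!)^{n²} P_{n,n²}(det_n))] -/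
theorem tableOfCube_fst (i : Fin (n * n)) (z : Fin n) :
    (tableOfCube n α).1 i z =
      (finProdFinEquiv.symm ((Equiv.ofBijective _ (hα.2.2 z)).symm i)).1 := by
  simp only [tableOfCube, dif_pos (hα.2.2 z)]

/-- Unfolding `tableOfCube` on a Latin cube (second table). [cite: BurgisserIkenmeyer2017, §5.2 Prop. 5.22 / Problem 5.23 with §3.3 Prop. 3.28, eq. (3.9) (signed counts, F_n(⟨n²⟩) = ±(n!)^{n²} P_{n,n²}(det_n))] -/
theorem tableOfCube_snd (i : Fin (n * n)) (z : Fin n) :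
    (tableOfCube n α).2 i z =
      (finProdFinEquiv.symm ((Equiv.ofBijective _ (hα.2.2 z)).symm i)).2 := by
  simp only [tableOfCube, dif_pos (hα.2.2 z)]

/-- The symbol `i` sits at `(S(i,z), T(i,z), z)`. [cite: BurgisserIkenmeyer2017, §5.2 Prop. 5.22 / Problem 5.23 with §3.3 Prop. 3.28, eq. (3.9) (signed counts, F_n(⟨n²⟩) = ±(n!)^{n²} P_{n,n²}(det_n))] -/
theorem apply_tableOfCube (i : Fin (n * n)) (z : Fin n) :
    α ((tableOfCube n α).1 i z, (tableOfCube n α).2 i z, z) = i := by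
  rw [tableOfCube_fst hα, tableOfCube_snd hα]
  exact Equiv.ofBijective_apply_symm_apply (zSliceMap n α z) (hα.2.2 z) i

/-- … and nowhere else in the `z`-slice. [cite: BurgisserIkenmeyer2017, §5.2 Prop. 5.22 / Problem 5.23 with §3.3 Prop. 3.28, eq. (3.9) (signed counts, F_n(⟨n²⟩) = ±(n!)^{n²} P_{n,n²}(det_n))] -/
theorem tableOfCube_eq_of {r c z : Fin n} {i : Fin (n * n)} (hi : α (r, c, z) = i) :
    (tableOfCube n α).1 i z = r ∧ (tableOfCube n α).2 i z = c := by
  have hq : (Equiv.ofBijective _ (hα.2.2 z)).symm i = finProdFinEquiv (r, c) := by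
    rw [Equiv.symm_apply_eq]
    show i = zSliceMap n α z (finProdFinEquiv (r, c))
    simp [zSliceMap, hi]
  rw [tableOfCube_fst hα, tableOfCube_snd hα, hq]
  simp

/-- The table of a Latin cube is admissible. [cite: BurgisserIkenmeyer2017, §5.2 Prop. 5.22 / Problem 5.23 with §3.3 Prop. 3.28, eq. (3.9) (signed counts, F_n(⟨n²⟩) = ±(n!)^{n²} P_{n,n²}(det_n))] -/
theorem isAdmissibleTable_tableOfCube :
    IsAdmissibleTable (tableOfCube n α).1 (tableOfCube n α).2 := by
  refine ⟨fun i => ?_, fun i => ?_, fun z => ?_⟩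
  · -- rows of `S`: symbol `i` meets each `x`-slice once
    refine Finite.injective_iff_bijective.mp fun z₁ z₂ hz => ?_
    have h₁ := apply_tableOfCube hα i z₁
    have h₂ := apply_tableOfCube hα i z₂
    set r := (tableOfCube n α).1 i z₁
    have e₁ : xSliceMap n α r (finProdFinEquiv ((tableOfCube n α).2 i z₁, z₁)) = i := by
      simp [xSliceMap, h₁]
    have e₂ : xSliceMap n α r (finProdFinEquiv ((tableOfCube n α).2 i z₂, z₂)) = i := by
      simp only [xSliceMap, Equiv.symm_apply_apply]; rw [hz]; exact h₂
    have := (hα.1 r).1 (e₁.trans e₂.symm)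
    exact (Prod.mk.inj (finProdFinEquiv.injective this)).2
  · -- rows of `T`: symbol `i` meets each `y`-slice once
    refine Finite.injective_iff_bijective.mp fun z₁ z₂ hz => ?_
    have h₁ := apply_tableOfCube hα i z₁
    have h₂ := apply_tableOfCube hα i z₂
    set c := (tableOfCube n α).2 i z₁
    have e₁ : ySliceMap n α c (finProdFinEquiv ((tableOfCube n α).1 i z₁, z₁)) = i := by
      simp [ySliceMap, h₁]
    have e₂ : ySliceMap n α c (finProdFinEquiv ((tableOfCube n α).1 i z₂, z₂)) = i := by
      simp only [ySliceMap, Equiv.symm_apply_apply]; rw [hz]; exact h₂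
    have := (hα.2.1 c).1 (e₁.trans e₂.symm)
    exact (Prod.mk.inj (finProdFinEquiv.injective this)).2
  · -- columns: the inverse of the `z`-slice bijection
    have : (fun i => ((tableOfCube n α).1 i z, (tableOfCube n α).2 i z)) =
        ⇑finProdFinEquiv.symm ∘ ⇑(Equiv.ofBijective _ (hα.2.2 z)).symm := by
      funext i
      simp only [tableOfCube_fst hα, tableOfCube_snd hα, Function.comp_apply, Prod.mk.eta]
    rw [this]
    exact finProdFinEquiv.symm.bijective.comp (Equiv.ofBijective _ (hα.2.2 z)).symm.bijective

/-- Right inverse: the cube of the table of a Latin cube is the cube. [cite: BurgisserIkenmeyer2017, §5.2 Prop. 5.22 / Problem 5.23 with §3.3 Prop. 3.28, eq. (3.9) (signed counts, F_n(⟨n²⟩) = ±(n!)^{n²} P_{n,n²}(det_n))] -/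
theorem cubeOfTable_tableOfCube : cubeOfTable (tableOfCube n α).1 (tableOfCube n α).2 = α := by
  funext ⟨r, c, z⟩
  have h2 := tableOfCube_eq_of hα (rfl : α (r, c, z) = α (r, c, z))
  exact cubeOfTable_eq_of (isAdmissibleTable_tableOfCube hα) h2.1 h2.2

end Cube

/-- Left inverse: the table of the cube of an admissible table is the table. [cite: BurgisserIkenmeyer2017, §5.2 Prop. 5.22 / Problem 5.23 with §3.3 Prop. 3.28, eq. (3.9) (signed counts, F_n(⟨n²⟩) = ±(n!)^{n²} P_{n,n²}(det_n))] -/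
theorem tableOfCube_cubeOfTable {S T : Fin (n * n) → Fin n → Fin n} (h : IsAdmissibleTable S T) :
    tableOfCube n (cubeOfTable S T) = (S, T) := by
  have hL := isLatinCube_cubeOfTable h
  refine Prod.ext (funext fun i => funext fun z => ?_) (funext fun i => funext fun z => ?_)
  · exact (tableOfCube_eq_of hL (cubeOfTable_eq_of h (i := i) (z := z) rfl rfl)).1
  · exact (tableOfCube_eq_of hL (cubeOfTable_eq_of h (i := i) (z := z) rfl rfl)).2

/-! ### The signed counts agree -/

/-- **Latin cubes of size `n` ARE the admissible `n`-tables, with signs agreeing up to the fixed sign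
`sign(twist_n) = sign(swap on [n]×[n])^n`:**
`#{even} − #{odd Latin cubes} = sign(twist_n) · (#{even} − #{odd admissible n-tables})`.
[cite: BurgisserIkenmeyer2017, §5.2 Prop. 5.22 / Problem 5.23 with §3.3 Prop. 3.28, eq. (3.9) (signed counts, F_n(⟨n²⟩) = ±(n!)^{n²} P_{n,n²}(det_n))] (the observation of this file; BI 2017 treat Prop. 3.28 and Problem 5.23 separately) -/
theorem latinCubeCount_eq_sign_twist_mul_admissibleTableCount (n : ℕ) :
    latinCubeCount n =
      ((Equiv.Perm.sign (twist n) : ℤˣ) : ℤ) * admissibleTableCount n := by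
  classical
  rw [latinCubeCount, admissibleTableCount, Finset.mul_sum]
  symm
  refine Finset.sum_nbij' (fun ST => cubeOfTable ST.1 ST.2) (fun α => tableOfCube n α) ?_ ?_ ?_ ?_ ?_
  · intro ST hST
    simp only [Finset.mem_filter, Finset.mem_univ, true_and] at hST ⊢
    exact isLatinCube_cubeOfTable hST
  · intro α hα
    simp only [Finset.mem_filter, Finset.mem_univ, true_and] at hα ⊢
    exact isAdmissibleTable_tableOfCube hα
  · intro ST hST
    simp only [Finset.mem_filter, Finset.mem_univ, true_and] at hST
    exact tableOfCube_cubeOfTable hST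
  · intro α hα
    simp only [Finset.mem_filter, Finset.mem_univ, true_and] at hα
    exact cubeOfTable_tableOfCube hα
  · intro ST hST
    simp only [Finset.mem_filter, Finset.mem_univ, true_and] at hST
    exact (latinCubeSign_cubeOfTable hST).symm

/-- The sign is `sign(swap)^n`, hence `+1` for every even `n`. [cite: BurgisserIkenmeyer2017, §5.2 Prop. 5.22 / Problem 5.23 with §3.3 Prop. 3.28, eq. (3.9) (signed counts, F_n(⟨n²⟩) = ±(n!)^{n²} P_{n,n²}(det_n))] -/
theorem latinCubeCount_eq_admissibleTableCount_of_even {n : ℕ} (hn : Even n) :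
    latinCubeCount n = admissibleTableCount n := by
  rw [latinCubeCount_eq_sign_twist_mul_admissibleTableCount, sign_twist]
  rcases Int.units_eq_one_or (Equiv.Perm.sign (Equiv.prodComm (Fin n) (Fin n))) with h | h
  · rw [h, Units.val_one, one_pow, one_mul]
  · rw [h, Units.val_neg, Units.val_one, hn.neg_one_pow, one_mul]

/-- **Nonvanishing is the same question.** [cite: BurgisserIkenmeyer2017, §5.2 Prop. 5.22 / Problem 5.23 with §3.3 Prop. 3.28, eq. (3.9) (signed counts, F_n(⟨n²⟩) = ±(n!)^{n²} P_{n,n²}(det_n))] -/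
theorem latinCubeCount_ne_zero_iff (n : ℕ) : latinCubeCount n ≠ 0 ↔ admissibleTableCount n ≠ 0 := by
  rw [latinCubeCount_eq_sign_twist_mul_admissibleTableCount]
  rw [mul_ne_zero_iff]
  exact ⟨fun h => h.2, fun h => ⟨Units.ne_zero _, h⟩⟩

/-! ### Consequences: `F_n(⟨n²⟩)` versus `P_{n,n²}(det_n)`; BI Problem 5.23 ⟺ `e(det_n) = n²` -/

open _root_.MvPolynomial

/-- **`P_{n,n²}(det_n) ≠ 0` iff the Latin-cube count is nonzero** (via BI Prop. 3.28,
`BI2017_prop_3_28_holds`). [cite: BurgisserIkenmeyer2017, §5.2 Prop. 5.22 / Problem 5.23 with §3.3 Prop. 3.28, eq. (3.9) (signed counts, F_n(⟨n²⟩) = ±(n!)^{n²} P_{n,n²}(det_n))] -/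
theorem cayleyP_det_ne_zero_iff_latinCubeCount_ne_zero (n : ℕ) :
    aeval (formCoeff n (detPoly (Fin n) ℂ))
        (cayleyP (k := ℂ) n (finProdFinEquiv.symm : Fin (n * n) ≃ Fin n × Fin n)) ≠ 0 ↔
      latinCubeCount n ≠ 0 := by
  rw [latinCubeCount_ne_zero_iff]
  have h328 := (BI2017_prop_3_28_holds n).1
  have hfac : ((Nat.factorial n : ℂ)) ^ (n * n) ≠ 0 :=
    pow_ne_zero _ (Nat.cast_ne_zero.mpr (Nat.factorial_ne_zero n))
  constructor
  · intro hP hc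
    rw [hc, Int.cast_zero] at h328
    exact (mul_ne_zero hfac hP) h328
  · intro hc hP
    rw [hP, mul_zero] at h328
    exact hc (by exact_mod_cast h328.symm)

/-- **`F_n(⟨n²⟩) = sign(twist_n) · (n!)^{n²} · P_{n,n²}(det_n)`** (BI Prop. 5.22 with Prop. 3.28 and
the bijection of this file). [cite: BurgisserIkenmeyer2017, §5.2 Prop. 5.22 / Problem 5.23 with §3.3 Prop. 3.28, eq. (3.9) (signed counts, F_n(⟨n²⟩) = ±(n!)^{n²} P_{n,n²}(det_n))] -/
theorem fundInvariantTensor_unitTensor_eq_cayleyP_det (n : ℕ) :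
    aeval (tensorPt (unitTensor ℂ (n * n))) (fundInvariantTensor n ℂ) =
      ((Equiv.Perm.sign (twist n) : ℤˣ) : ℤ) * ((Nat.factorial n : ℂ) ^ (n * n) *
        aeval (formCoeff n (detPoly (Fin n) ℂ))
          (cayleyP (k := ℂ) n (finProdFinEquiv.symm : Fin (n * n) ≃ Fin n × Fin n))) := by
  rw [(BI2017_prop_5_22_holds n).1, (BI2017_prop_3_28_holds n).1,
    latinCubeCount_eq_sign_twist_mul_admissibleTableCount]
  push_cast
  rfl

/-- **BI 2017 Problem 5.23 ⟺ `e(det_n) = n²`** (`2 ≤ n`): the number of even Latin cubes of size `n`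
differs from the number of odd ones iff the fundamental invariant `P_{n,n²}` does not vanish at
`det_n`, iff the minimal degree of `GL_{n²}·det_n` is `n²` (BI Prop. 3.25 (`BI2017_minimalDegree_det_per_holds`),
Prop. 3.28, Prop. 5.22) — two questions the source poses separately ("important for understanding
tensor border rank", §5.2; "for geometric complexity theory it would be important to know", §3.3).
[cite: BurgisserIkenmeyer2017, §5.2 Prop. 5.22 / Problem 5.23 with §3.3 Prop. 3.28, eq. (3.9) (signed counts, F_n(⟨n²⟩) = ±(n!)^{n²} P_{n,n²}(det_n))] -/
theorem latinCubeQuestion_iff_minimalDegree_det {n : ℕ} (hn : 2 ≤ n) :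
    latinCubeQuestion n ↔ minimalDegree n (detPoly (Fin n) ℂ) = n * n := by
  rw [latinCubeQuestion, (BI2017_minimalDegree_det_per_holds.1 n hn).1.2,
    cayleyP_det_ne_zero_iff_latinCubeCount_ne_zero]

/-- The same with `P_{n,n²}(det_n)`. [cite: BurgisserIkenmeyer2017, §5.2 Prop. 5.22 / Problem 5.23 with §3.3 Prop. 3.28, eq. (3.9) (signed counts, F_n(⟨n²⟩) = ±(n!)^{n²} P_{n,n²}(det_n))] -/
theorem latinCubeQuestion_iff_cayleyP_det_ne_zero (n : ℕ) :
    latinCubeQuestion n ↔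
      aeval (formCoeff n (detPoly (Fin n) ℂ))
        (cayleyP (k := ℂ) n (finProdFinEquiv.symm : Fin (n * n) ≃ Fin n × Fin n)) ≠ 0 := by
  rw [latinCubeQuestion, cayleyP_det_ne_zero_iff_latinCubeCount_ne_zero]

/-! ### The two computational facts of the tree are one -/

/-- `BI2017_latinCube_2_4` ⟺ `#{even} ≠ #{odd admissible 4-tables}` (the `n = 2` conjunct is the
theorem `latinCubeCount_two_ne_zero`). [cite: BurgisserIkenmeyer2017, §5.2 Prop. 5.22 / Problem 5.23 with §3.3 Prop. 3.28, eq. (3.9) (signed counts, F_n(⟨n²⟩) = ±(n!)^{n²} P_{n,n²}(det_n))] -/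
theorem BI2017_latinCube_2_4_iff_admissibleTableCount_four :
    BI2017_latinCube_2_4 ↔ admissibleTableCount 4 ≠ 0 := by
  rw [BI2017_latinCube_2_4, ← latinCubeCount_ne_zero_iff]
  exact ⟨fun h => h.2, fun h => ⟨latinCubeCount_two_ne_zero, h⟩⟩

/-- `BI2017_latinCube_2_4` ⟺ `P_{4,16}(det_4) ≠ 0` (the `det` half of `BI2017_P416_det_per`). [cite: BurgisserIkenmeyer2017, §5.2 Prop. 5.22 / Problem 5.23 with §3.3 Prop. 3.28, eq. (3.9) (signed counts, F_n(⟨n²⟩) = ±(n!)^{n²} P_{n,n²}(det_n))] -/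
theorem BI2017_latinCube_2_4_iff_cayleyP_det_four :
    BI2017_latinCube_2_4 ↔
      aeval (formCoeff 4 (detPoly (Fin 4) ℂ))
        (cayleyP (k := ℂ) 4 (finProdFinEquiv.symm : Fin (4 * 4) ≃ Fin 4 × Fin 4)) ≠ 0 := by
  rw [cayleyP_det_ne_zero_iff_latinCubeCount_ne_zero, BI2017_latinCube_2_4]
  exact ⟨fun h => h.2, fun h => ⟨latinCubeCount_two_ne_zero, h⟩⟩

/-- **Edge**: `BI2017_P416_det_per → BI2017_latinCube_2_4`. [cite: BurgisserIkenmeyer2017, §5.2 Prop. 5.22 / Problem 5.23 with §3.3 Prop. 3.28, eq. (3.9) (signed counts, F_n(⟨n²⟩) = ±(n!)^{n²} P_{n,n²}(det_n))] -/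
theorem BI2017_latinCube_2_4_of_P416 (h : BI2017_P416_det_per) : BI2017_latinCube_2_4 :=
  BI2017_latinCube_2_4_iff_cayleyP_det_four.mpr h.1

/-- **Edge**: `BI2017_latinCube_2_4 → e(det_4) = 16`. [cite: BurgisserIkenmeyer2017, §5.2 Prop. 5.22 / Problem 5.23 with §3.3 Prop. 3.28, eq. (3.9) (signed counts, F_n(⟨n²⟩) = ±(n!)^{n²} P_{n,n²}(det_n))] -/
theorem minimalDegree_det_four_of_latinCube (h : BI2017_latinCube_2_4) :
    minimalDegree 4 (detPoly (Fin 4) ℂ) = 4 * 4 :=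
  (latinCubeQuestion_iff_minimalDegree_det (by norm_num)).mp h.2

/-- **For every `n`: `#{even} − #{odd Latin cubes of size n} = #{even} − #{odd admissible n-tables}`**
(even `n`: the sign is `+1`; odd `n ≥ 3`: both sides vanish — `latinCubeCount_eq_zero_of_odd` and
BI Prop. 3.28 with `cayleyP_eq_zero_of_odd`; `n = 1`: the twist of a one-point set is trivial). [cite: BurgisserIkenmeyer2017, §5.2 Prop. 5.22 / Problem 5.23 with §3.3 Prop. 3.28, eq. (3.9) (signed counts, F_n(⟨n²⟩) = ±(n!)^{n²} P_{n,n²}(det_n))] -/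
theorem latinCubeCount_eq_admissibleTableCount (n : ℕ) : latinCubeCount n = admissibleTableCount n := by
  rcases Nat.even_or_odd n with hn | hn
  · exact latinCubeCount_eq_admissibleTableCount_of_even hn
  · by_cases h1 : n = 1
    · subst h1
      rw [latinCubeCount_eq_sign_twist_mul_admissibleTableCount, sign_twist,
        Equiv.Perm.subsingleton_eq_refl (Equiv.prodComm (Fin 1) (Fin 1)), Equiv.Perm.sign_refl,
        Units.val_one, one_pow, one_mul]
    · have h3 : 1 < n := by
        rcases hn with ⟨k, rfl⟩
        omega
      have h2 : 2 ≤ n * n := by nlinarith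
      rw [latinCubeCount_eq_zero_of_odd hn h3]
      have h328 := (BI2017_prop_3_28_holds n).1
      rw [cayleyP_eq_zero_of_odd hn h2, map_zero, mul_zero] at h328
      exact_mod_cast h328

end Literature.Computability.AlgebraicComplexity.BI17LatinCubesAdmissibleTables

end Part2

/-! ## Part 3 — the EXACT discharge of `BI2017_latinCube_2_4` -/

namespace Literature.Computability.AlgebraicComplexity

/-- **The Literature named fact `BI2017_latinCube_2_4` HOLDS**: the signed Latin-cube counts at `n = 2` and `n = 4` are non-zero
(Bürgisser–Ikenmeyer 2017 §5.2, there a computer verification; here `BI17TwoLevelCut.admissibleTableCount_four_pos` by algebra +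
`BI17LatinCubesAdmissibleTables.BI2017_latinCube_2_4_iff_admissibleTableCount_four`).  EXACT discharge, Literature-side twin of
`Summit.ValiantsHypothesis.BI17LatinCubesAdmissibleTables.BI2017_latinCube_2_4_holds`.
[cite: BurgisserIkenmeyer2017, §5.2 (before Problem 5.23)] -/
theorem BI2017_latinCube_2_4_holds : BI2017_latinCube_2_4 :=
  BI17LatinCubesAdmissibleTables.BI2017_latinCube_2_4_iff_admissibleTableCount_four.mpr
    (BI17TwoLevelCut.admissibleTableCount_four_pos).ne'

end Literature.Computability.AlgebraicComplexity

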